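import Summits.QuantumFields.YangMills.Theorems.LuscherReductionTwistedTraceScalingInnerModelPerturbed
import Summits.QuantumFields.YangMills.Theorems.TwistedTraceScaling.Negative.InnerBOPackageIffInner
import HarnessLib

/-!
# R21 (crux `TwistedTraceScaling`, stmt-QuantumFields-20203; C4 INNER, lane A's brick O′ `…InnerModelPerturbed`, p605943): the GLOBAL relative-closeness
# hypothesis `hnear` of `true_boOrth_le` / `true_boProj_boOrth` / `true_boProj_boProj` is RIGID — it admits no slow-dependence of the stiff Gaussian data
# and no unbounded weight — and a box-uniform FIRST-ORDER off-diagonal size `b ≳ β^{−p}` violates the package budget `b² ≤ εθλ_b/16` for every `p < 1/6`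

Standing disprover `ym-cdisprove-20203-1` (gen 17), sequel to R18 (`…Negative.InnerBOPackageIffInner`: the package is INNER in a costume), R19
(`…Negative.KernelNearEtaFloor`: D0 tight in `η`) and R20 (`…Negative.FeshbachEndgameTight`: the endgame tight in `b`).  Lane A g11's brick O′ (COARSE-DESIGN
§21.8 (ii) / §21.9 step (6)–(8)) delivers the STIFF / OFF-DIAG / DIAG clauses of `InnerBOPackageAt` for ANY kernel `K₂` on `C × ℝ^σ` under
`hnear : ∀ x x', |K₂ x x' − 1·(k ⊗ K_Mehler)(x,x')| ≤ η·1·(k ⊗ K_Mehler)(x,x')` — GLOBAL in both slow points `c, c'` AND both stiff points `q, q' ∈ ℝ^σ` — with the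
off-diagonal size `b ∝ η` («`b = η`, `θ = 1 − ρ − η`», §21.8 (ii)).  §21.9 intends `K₂ =` the lattice kernel in the product chart, whose stiff Gaussian form is
`𝔸₀ + 𝔹₁(c,c')` with `𝔹₁` LINEAR in the slow data (first order, `β𝔹₁ = O(β^{−1/4})` «pointwise on the bulk»), times Jacobians `J₀(1 + O(|c|² + |q|))`.
This file records two kernel-checked facts about that plan.

§1 RIGIDITY of the global `hnear` (elementary; `η < 1`, the only informative range):
* ★ `stiffData_eq_of_near` — if `K₂((c,q),(c',q')) = k(c,c')·K_Mehler^{A(c,c'),B(c,c')}(q,q')` is fibrewise Mehler with slow-DEPENDENT stiff data `A, B : C → C → σ → ℝ`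
  and satisfies `hnear` against `k ⊗ K_Mehler^{a,b}` with some `η < 1`, then `A(c,c') = a` and `B(c,c') = b` at EVERY pair with `k(c,c') > 0`: the log-ratio
  `Σ_k [(a_k − A_k)(q_k² + q'_k²) + (b_k − B_k)(q_k − q'_k)²]` (`mehlerKernel_div_mehlerKernel`) is pinned to `[log(1−η), log(1+η)]` on all of `ℝ^σ × ℝ^σ`, and a bounded
  quadratic monomial vanishes (`eq_zero_of_mul_sq_bounded`; test points `t·e_j`);
* `not_near_of_stiffData_ne` — contrapositive: ANY slow-dependence of the stiff widths (in particular the first-order `𝔹₁(c,c') ≠ 0` of §21.2/§21.9) defeats `hnear` for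
  every `η < 1`; `not_near_of_unbounded_weight` — so does any weight `w(q)` unbounded above (the Jacobian factor `1 + O(|q|)`, the cubic remainder `e^{Cβ|q|³}`).
  CONSEQUENCE (typing, not mathematics): O′ as landed cannot be fed by §21.9's `K` «η-sandwich on the bulk + Gaussian tails» — the three theorems need a restatement
  with `hnear` on a measurable sub-region `S ⊂ C × ℝ^σ` plus an ABSOLUTE tail `τ` off `S` (the true kernel EXCEEDS the Gaussian model off the stiff bulk: the Wilson
  action is sub-quadratic, `1 − cos x ≤ x²/2`, so no one-sided relative domination holds there either; only `|K₂ − k⊗K| ≤ η·k⊗K + τ·𝟙_{Sᶜ}` with `τ` super-polynomially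
  small is available), and test functions of the package live on the whole box `orbitDist < β^{−p}` (`|w| ≲ β^{−p} ≫ β^{−1/2}`).
§2 THE BOX-UNIFORM `b` (COARSE-DESIGN §21.3: «`b ≍ β^{−1/4}` ⇒ `b² ≍ β^{−1/2} = o(λ_b)`» evaluates the first-order coupling at the ONE-SITE BULK; the package's `∃ σ b, ∀ G`
quantifies over all admissible families in the box `powScale p`, whose valley extent is `|c| ≍ β^{−p}`, so a `b` produced from a first-order `η(c) ≍ |c|` is `≥ κ·β^{−p}`):
* ★ `lambda_mul_lt_first_order_sq (hp : p < 1/6) (hκ : 0 < κ) (C)` : eventually `C·λ_b(L³β) < (κ·β^{−p})²` (`λ_b(L³β) = (2/L³)^{1/3}β^{−1/3}`, `…ValleySkeleton.powScale_dominates_bareLambda`);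
* ★ `offDiag_budget_false_of_first_order (hp : p < 1/6) (hκ : 0 < κ)` : `¬ ∃ β0, ∀ β ≥ β0, ∃ b, κ·powScale p β ≤ b ∧ b² ≤ ε·θ·λ_b(L³β)/16` — the OFF-DIAG budget of
  `InnerBOPackageAt` (any real `ε, θ`) is violated by every box-uniform first-order `b`; `diag_budget_false_of_second_order` — likewise a second-order DIAG constant
  `η₂ ≥ κ·powScale (2p) β` against any budget `ε·λ_b(L³β)` (the SLOW clause's `e^{ελ_b/4}`); `offDiag_budget_false_on_door_window` / `diag_budget_false_on_door_window` —
  in particular on the whole door window `0 < p < 2/51` of R16/R18 (`2/51 < 1/6`).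
READING (Disproof.lean VERDICT 17 / regime (9)(a)(b)(f)).  Nothing here refutes O′ (unconditional, correct) or the package; §1 says O′'s hypothesis must be re-typed
(region + absolute tail) before §21.9's kernel can meet it, §2 says that after re-typing, the constants `b` (OFF-DIAG, first order) and `η₂` (DIAG, second order) must be
evaluated at the sup over the region carrying the test families: on the box `powScale p`, `p < 2/51`, both budgets fail (`β^{−2p} ≫ λ_b`), so the valley annulus
`β^{−1/6} ≲ |c| < β^{−p}` must be cut away inside the `∃ u v` choice (`u := P(χ_{≤R}ψ)`, `v :=` the rest) with the one-site W-mode repulsion margin `≍ g₁|c| ≫ λ_b` on the annulus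
and an overlap estimate across the cut — the slow cut «brick R», absent from §21.5's G/K/Y/S/D/O/L/A; a package on `|c| ≤ R` alone does not feed the door (R16, R18).
HONEST FRAMING: elementary real analysis about the hypothesis shape of a helper (brick O′) and the constants of a stub interface (`InnerBOPackageAt`, S-BASE C4) of a child of
the CONDITIONAL reduction route (femto rung R2b1); not `¬TwistedTraceScaling`, not infinite volume, not a gap, not Clay.  Sorry-free, no new definition; axioms ⊆
{propext, Classical.choice, Quot.sound}.

## References
* M. Lüscher, Nucl. Phys. B219 (1983) 233, §3 (Born–Oppenheimer reduction to the constant modes). [Luscher1983]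
* B. Helffer, *Spectral Theory and its Applications*, CUP 2013, Lemma 7.1 (Schur's test). [Helffer2013]
-/

set_option autoImplicit false

noncomputable section

open MeasureTheory
open scoped Real BigOperators
open Summit.QuantumFields.YangMills.Theorems.FemtoTransferGap
open Summit.QuantumFields.YangMills.Theorems.FemtoTransferGap.Mehler

namespace Summit.QuantumFields.YangMills.Theorems.TwistedTraceScaling.Negative.R21

/-! ## §1 Rigidity of the global relative-closeness hypothesis of brick O′ -/

section Kernel

variable {X : Type*} {C : Type*} {σ : Type*} [Fintype σ]

/-- A bounded quadratic monomial vanishes: `(∀ t, |κ·t²| ≤ B) → κ = 0`. [folklore] -/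
theorem eq_zero_of_mul_sq_bounded {κ B : ℝ} (h : ∀ t : ℝ, |κ * t ^ 2| ≤ B) : κ = 0 := by
  by_contra hκ
  have hκ' : 0 < |κ| := abs_pos.2 hκ
  have hB : 0 ≤ B := le_trans (abs_nonneg _) (h 0)
  have ht : Real.sqrt ((B + 1) / |κ|) ^ 2 = (B + 1) / |κ| := Real.sq_sqrt (by positivity)
  have h1 := h (Real.sqrt ((B + 1) / |κ|))
  rw [abs_mul, abs_of_nonneg (sq_nonneg (Real.sqrt ((B + 1) / |κ|))), ht] at h1
  have e : |κ| * ((B + 1) / |κ|) = B + 1 := by field_simp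
  linarith [e]

/-- Off-diagonal pinning: `hnear` (with `s = 1`) at a point with `K₁(x,y) > 0` gives `1 − η ≤ K₂(x,y)/K₁(x,y) ≤ 1 + η`. [cite: Helffer2013, Lemma 7.1] -/
theorem ratio_bounds_of_near {K₁ K₂ : X → X → ℝ} {η : ℝ} (hnear : ∀ x y, |K₂ x y - 1 * K₁ x y| ≤ η * 1 * K₁ x y)
    {x y : X} (hx : 0 < K₁ x y) :
    1 - η ≤ K₂ x y / K₁ x y ∧ K₂ x y / K₁ x y ≤ 1 + η := by
  have h := abs_le.1 (hnear x y)
  rw [one_mul, mul_one] at h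
  constructor
  · rw [le_div_iff₀ hx]
    nlinarith [h.1]
  · rw [div_le_iff₀ hx]
    nlinarith [h.2]

/-- The ratio of two Mehler kernels is the exponential of the log-ratio quadratic form
`Σ_k [(a_k − A_k)(x_k² + y_k²) + (b_k − B_k)(x_k − y_k)²]`. [folklore] -/
theorem mehlerKernel_div_mehlerKernel (a b A B : σ → ℝ) (x y : σ → ℝ) :
    mehlerKernel A B x y / mehlerKernel a b x y =
      Real.exp (∑ k, ((a k - A k) * (x k ^ 2 + y k ^ 2) + (b k - B k) * (x k - y k) ^ 2)) := by
  unfold mehlerKernel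
  rw [← Real.exp_sub]
  congr 1
  rw [neg_sub_neg, ← Finset.sum_sub_distrib]
  exact Finset.sum_congr rfl fun k _ => by ring

/-- The log-ratio form at the test points `x = y = t·e_j`: `2(a_j − A_j)t²`. [folklore] -/
theorem logRatio_single_single [DecidableEq σ] (a b A B : σ → ℝ) (j : σ) (t : ℝ) :
    (∑ k, ((a k - A k) * ((Pi.single j t : σ → ℝ) k ^ 2 + (Pi.single j t : σ → ℝ) k ^ 2) +
        (b k - B k) * ((Pi.single j t : σ → ℝ) k - (Pi.single j t : σ → ℝ) k) ^ 2)) = 2 * (a j - A j) * t ^ 2 := by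
  rw [Finset.sum_eq_single j]
  · rw [Pi.single_eq_same]; ring
  · intro k _ hk
    rw [Pi.single_eq_of_ne hk]; ring
  · intro h; exact absurd (Finset.mem_univ j) h

/-- The log-ratio form at the test points `x = t·e_j`, `y = 0`: `(a_j − A_j + b_j − B_j)t²`. [folklore] -/
theorem logRatio_single_zero [DecidableEq σ] (a b A B : σ → ℝ) (j : σ) (t : ℝ) :
    (∑ k, ((a k - A k) * ((Pi.single j t : σ → ℝ) k ^ 2 + (0 : σ → ℝ) k ^ 2) +
        (b k - B k) * ((Pi.single j t : σ → ℝ) k - (0 : σ → ℝ) k) ^ 2)) = (a j - A j + (b j - B j)) * t ^ 2 := by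
  rw [Finset.sum_eq_single j]
  · rw [Pi.single_eq_same, Pi.zero_apply]; ring
  · intro k _ hk
    rw [Pi.single_eq_of_ne hk, Pi.zero_apply]; ring
  · intro h; exact absurd (Finset.mem_univ j) h

/-- **The log-ratio is pinned** by `hnear` (fibrewise-Mehler `K₂` with slow-dependent data `A, B`): at every slow pair with `k(c,c') > 0` and every `q, q'`,
`log(1 − η) ≤ Σ_k [(a_k − A_k)(q_k² + q'_k²) + (b_k − B_k)(q_k − q'_k)²] ≤ log(1 + η)`. [cite: Helffer2013, Lemma 7.1] -/
theorem logRatio_bounds_of_near {k : C → C → ℝ} {a b : σ → ℝ} {A B : C → C → σ → ℝ} {η : ℝ} (hη : η < 1)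
    (hnear : ∀ x x' : C × (σ → ℝ),
      |k x.1 x'.1 * mehlerKernel (A x.1 x'.1) (B x.1 x'.1) x.2 x'.2 - 1 * tensorKernel k a b x x'| ≤ η * 1 * tensorKernel k a b x x')
    {c c' : C} (hk : 0 < k c c') (q q' : σ → ℝ) :
    Real.log (1 - η) ≤ ∑ j, ((a j - A c c' j) * (q j ^ 2 + q' j ^ 2) + (b j - B c c' j) * (q j - q' j) ^ 2) ∧
      ∑ j, ((a j - A c c' j) * (q j ^ 2 + q' j ^ 2) + (b j - B c c' j) * (q j - q' j) ^ 2) ≤ Real.log (1 + η) := by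
  have hK : 0 < tensorKernel k a b (c, q) (c', q') := by
    unfold tensorKernel
    exact mul_pos hk (mehlerKernel_pos a b q q')
  have h := ratio_bounds_of_near (K₁ := tensorKernel k a b)
    (K₂ := fun x x' : C × (σ → ℝ) => k x.1 x'.1 * mehlerKernel (A x.1 x'.1) (B x.1 x'.1) x.2 x'.2) hnear hK
  have hratio : (k c c' * mehlerKernel (A c c') (B c c') q q') / tensorKernel k a b (c, q) (c', q') =
      Real.exp (∑ j, ((a j - A c c' j) * (q j ^ 2 + q' j ^ 2) + (b j - B c c' j) * (q j - q' j) ^ 2)) := by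
    unfold tensorKernel
    rw [mul_div_mul_left _ _ hk.ne', mehlerKernel_div_mehlerKernel]
  simp only [hratio] at h
  have h1η : 0 < 1 - η := by linarith
  constructor
  · have := Real.log_le_log h1η h.1
    rwa [Real.log_exp] at this
  · have := Real.log_le_log (Real.exp_pos _) h.2
    rwa [Real.log_exp] at this

/-- ★ **RIGIDITY**: a fibrewise-Mehler kernel `K₂((c,q),(c',q')) = k(c,c')·K_Mehler^{A(c,c'),B(c,c')}(q,q')` with slow-DEPENDENT stiff data satisfies the global `hnear` of
`…InnerModelPerturbed` against `k ⊗ K_Mehler^{a,b}` with some `η < 1` only if `A(c,c') = a` and `B(c,c') = b` wherever `k(c,c') > 0` — the hypothesis admits NO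
slow-dependence of the stiff Gaussian data (in particular not the first-order `𝔹₁(c,c')` of COARSE-DESIGN §21.2/§21.9). [cite: Luscher1983, §3] [cite: Helffer2013, Lemma 7.1] -/
theorem stiffData_eq_of_near {k : C → C → ℝ} {a b : σ → ℝ} {A B : C → C → σ → ℝ} {η : ℝ} (hη : η < 1)
    (hnear : ∀ x x' : C × (σ → ℝ),
      |k x.1 x'.1 * mehlerKernel (A x.1 x'.1) (B x.1 x'.1) x.2 x'.2 - 1 * tensorKernel k a b x x'| ≤ η * 1 * tensorKernel k a b x x')
    {c c' : C} (hk : 0 < k c c') (j : σ) : A c c' j = a j ∧ B c c' j = b j := by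
  classical
  set Bd : ℝ := |Real.log (1 - η)| + |Real.log (1 + η)| with hBd
  have hbound : ∀ q q' : σ → ℝ,
      |∑ i, ((a i - A c c' i) * (q i ^ 2 + q' i ^ 2) + (b i - B c c' i) * (q i - q' i) ^ 2)| ≤ Bd := by
    intro q q'
    obtain ⟨h1, h2⟩ := logRatio_bounds_of_near hη hnear hk q q'
    rw [abs_le]
    constructor
    · have : -|Real.log (1 - η)| ≤ Real.log (1 - η) := neg_abs_le _
      linarith [abs_nonneg (Real.log (1 + η))]
    · have : Real.log (1 + η) ≤ |Real.log (1 + η)| := le_abs_self _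
      linarith [abs_nonneg (Real.log (1 - η))]
  -- `x = y = t·e_j`: `2(a_j − A_j)t²` bounded ⇒ `A_j = a_j`
  have hA : A c c' j = a j := by
    have h2 : ∀ t : ℝ, |2 * (a j - A c c' j) * t ^ 2| ≤ Bd := by
      intro t
      have := hbound (Pi.single j t) (Pi.single j t)
      rwa [logRatio_single_single] at this
    have := eq_zero_of_mul_sq_bounded h2
    linarith
  refine ⟨hA, ?_⟩
  -- `x = t·e_j`, `y = 0`: `(b_j − B_j)t²` bounded ⇒ `B_j = b_j`
  have h3 : ∀ t : ℝ, |(b j - B c c' j) * t ^ 2| ≤ Bd := by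
    intro t
    have := hbound (Pi.single j t) 0
    rw [logRatio_single_zero, hA, sub_self, zero_add] at this
    exact this
  have := eq_zero_of_mul_sq_bounded h3
  linarith

/-- **Contrapositive**: if the stiff data of `K₂` differ from `(a, b)` at a single coordinate over a single slow pair with `k(c,c') > 0`, then `hnear` fails for EVERY
`η < 1` (and `η ≥ 1` gives `b ≥ μ₁M`, useless for the package). [cite: Luscher1983, §3] -/
theorem not_near_of_stiffData_ne {k : C → C → ℝ} {a b : σ → ℝ} {A B : C → C → σ → ℝ}
    (h : ∃ c c' : C, ∃ j : σ, 0 < k c c' ∧ (A c c' j ≠ a j ∨ B c c' j ≠ b j)) :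
    ¬ ∃ η : ℝ, η < 1 ∧ ∀ x x' : C × (σ → ℝ),
      |k x.1 x'.1 * mehlerKernel (A x.1 x'.1) (B x.1 x'.1) x.2 x'.2 - 1 * tensorKernel k a b x x'| ≤ η * 1 * tensorKernel k a b x x' := by
  rintro ⟨η, hη, hnear⟩
  obtain ⟨c, c', j, hk, hne⟩ := h
  obtain ⟨hA, hB⟩ := stiffData_eq_of_near hη hnear hk j
  exact hne.elim (fun h => h hA) (fun h => h hB)

/-- **No unbounded weight**: a kernel `K₂ = w(q)·(k ⊗ K_Mehler)` with `w` unbounded above (a Jacobian factor `1 + O(|q|)`, a cubic remainder `e^{Cβ|q|³}` off the bulk)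
violates `hnear` for every `η`. [cite: Helffer2013, Lemma 7.1] -/
theorem not_near_of_unbounded_weight {k : C → C → ℝ} {a b : σ → ℝ} {w : (σ → ℝ) → ℝ} (hw : ∀ M : ℝ, ∃ q : σ → ℝ, M < w q)
    {c c' : C} (hk : 0 < k c c') (η : ℝ) :
    ¬ ∀ x x' : C × (σ → ℝ), |w x.2 * tensorKernel k a b x x' - 1 * tensorKernel k a b x x'| ≤ η * 1 * tensorKernel k a b x x' := by
  intro hnear
  obtain ⟨q, hq⟩ := hw (1 + η)
  have hK : 0 < tensorKernel k a b (c, q) (c', q) := by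
    unfold tensorKernel
    exact mul_pos hk (mehlerKernel_pos a b q q)
  have h := (ratio_bounds_of_near (K₁ := tensorKernel k a b) (K₂ := fun x x' : C × (σ → ℝ) => w x.2 * tensorKernel k a b x x') hnear hK).2
  simp only [mul_div_assoc] at h
  rw [div_self hK.ne', mul_one] at h
  linarith

end Kernel

/-! ## §2 A box-uniform first-order off-diagonal size violates the package budget for every `p < 1/6` -/

section Budget

variable (L : ℕ) [NeZero L]

/-- `(powScale p β)² = powScale (2p) β`. [folklore] -/
theorem powScale_sq (p β : ℝ) : powScale p β ^ 2 = powScale (2 * p) β := by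
  unfold powScale
  have h0 : (0 : ℝ) ≤ max β 1 := le_trans zero_le_one (le_max_right _ _)
  rw [← Real.rpow_natCast, ← Real.rpow_mul h0]
  congr 1
  push_cast
  ring

/-- ★ **Every multiple of `λ_b(L³β)` is eventually below `(κ·β^{−p})²` when `p < 1/6`** (`λ_b(L³β) = (2/L³)^{1/3}·β^{−1/3}`, `2p < 1/3`). [cite: Luscher1983, §3] -/
theorem lambda_mul_lt_first_order_sq {p κ : ℝ} (hp : p < 1 / 6) (hκ : 0 < κ) (C : ℝ) :
    ∃ β0 : ℝ, ∀ β : ℝ, β0 ≤ β → C * bareLambda ((L : ℝ) ^ 3 * β) < (κ * powScale p β) ^ 2 := by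
  have h2p : 2 * p < 1 / 3 := by linarith
  obtain ⟨β0, hβ0⟩ := powScale_dominates_bareLambda (L := L) h2p (2 * C / κ ^ 2)
  refine ⟨max β0 1, fun β hβ => ?_⟩
  have hβ1 : 1 ≤ β := (le_max_right _ _).trans hβ
  have hL : (0 : ℝ) < (L : ℝ) ^ 3 := by
    have : (0 : ℝ) < L := by exact_mod_cast Nat.pos_of_ne_zero (NeZero.ne L)
    positivity
  have hlam : 0 < bareLambda ((L : ℝ) ^ 3 * β) := bareLambda_pos' (by positivity)
  have hps : 0 < powScale p β := powScale_pos p β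
  have hsq : (κ * powScale p β) ^ 2 = κ ^ 2 * powScale (2 * p) β := by rw [mul_pow, powScale_sq]
  have hκ2 : 0 < κ ^ 2 := by positivity
  have h := hβ0 β ((le_max_left _ _).trans hβ)
  -- `(2C/κ²)·λ ≤ powScale (2p)` ⇒ `C·λ ≤ κ²·powScale(2p)/2 < κ²·powScale(2p)`
  rw [hsq]
  have hpos : 0 < κ ^ 2 * powScale (2 * p) β := mul_pos hκ2 (powScale_pos _ _)
  have h' : 2 * C * bareLambda ((L : ℝ) ^ 3 * β) ≤ κ ^ 2 * powScale (2 * p) β := by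
    have := mul_le_mul_of_nonneg_left h hκ2.le
    have e : κ ^ 2 * (2 * C / κ ^ 2 * bareLambda ((L : ℝ) ^ 3 * β)) = 2 * C * bareLambda ((L : ℝ) ^ 3 * β) := by
      field_simp
    linarith [e]
  by_cases hC : 0 < C
  · nlinarith [mul_pos hC hlam]
  · have hC' : C ≤ 0 := not_lt.1 hC
    have : C * bareLambda ((L : ℝ) ^ 3 * β) ≤ 0 := mul_nonpos_of_nonpos_of_nonneg hC' hlam.le
    linarith

/-- ★ **THE OFF-DIAGONAL BUDGET OF `InnerBOPackageAt` IS VIOLATED BY EVERY BOX-UNIFORM FIRST-ORDER `b`** (`p < 1/6`, any real `ε, θ`, any `L ≥ 1`): there is no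
threshold beyond which some `b ≥ κ·powScale p β` has `b² ≤ ε·θ·λ_b(L³β)/16`.  (O′ gives `b ∝ η`, and a first-order `η(c) ≍ |c|` over the box `powScale p` is
`≥ κ·β^{−p}`; by R20 the endgame needs the budget.) [cite: Luscher1983, §3] -/
theorem offDiag_budget_false_of_first_order {p κ : ℝ} (hp : p < 1 / 6) (hκ : 0 < κ) (ε θ : ℝ) :
    ¬ ∃ β0 : ℝ, ∀ β : ℝ, β0 ≤ β → ∃ b : ℝ, κ * powScale p β ≤ b ∧ b ^ 2 ≤ ε * θ * bareLambda ((L : ℝ) ^ 3 * β) / 16 := by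
  rintro ⟨β0, hβ0⟩
  obtain ⟨β1, hβ1⟩ := lambda_mul_lt_first_order_sq L hp hκ (ε * θ / 16)
  obtain ⟨b, hb, hb2⟩ := hβ0 (max β0 β1) (le_max_left _ _)
  have hlt := hβ1 (max β0 β1) (le_max_right _ _)
  have hps : 0 ≤ κ * powScale p (max β0 β1) := (mul_pos hκ (powScale_pos _ _)).le
  have hsq : (κ * powScale p (max β0 β1)) ^ 2 ≤ b ^ 2 := pow_le_pow_left₀ hps hb 2
  have e : ε * θ * bareLambda ((L : ℝ) ^ 3 * max β0 β1) / 16 = ε * θ / 16 * bareLambda ((L : ℝ) ^ 3 * max β0 β1) := by ring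
  linarith [e]

/-- ★ **THE DIAGONAL / SLOW BUDGET IS VIOLATED BY EVERY BOX-UNIFORM SECOND-ORDER CONSTANT** (`p < 1/6`, any real `ε`): no threshold beyond which some
`η₂ ≥ κ·powScale (2p) β` has `η₂ ≤ ε·λ_b(L³β)` (brick D / §21.9 step (7): `k_eff = σK₁(1 + O(η₂))` with `η₂(c) ≍ |c|²` over the box; the SLOW clause's
relative precision is `e^{ελ_b/4}`). [cite: Luscher1983, §3] -/
theorem diag_budget_false_of_second_order {p κ : ℝ} (hp : p < 1 / 6) (hκ : 0 < κ) (ε : ℝ) :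
    ¬ ∃ β0 : ℝ, ∀ β : ℝ, β0 ≤ β → ∃ η₂ : ℝ, κ * powScale (2 * p) β ≤ η₂ ∧ η₂ ≤ ε * bareLambda ((L : ℝ) ^ 3 * β) := by
  rintro ⟨β0, hβ0⟩
  have hsκ : 0 < Real.sqrt κ := Real.sqrt_pos.2 hκ
  obtain ⟨β1, hβ1⟩ := lambda_mul_lt_first_order_sq L hp hsκ ε
  obtain ⟨η₂, hη, hη2⟩ := hβ0 (max β0 β1) (le_max_left _ _)
  have hlt := hβ1 (max β0 β1) (le_max_right _ _)
  have e : (Real.sqrt κ * powScale p (max β0 β1)) ^ 2 = κ * powScale (2 * p) (max β0 β1) := by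
    rw [mul_pow, Real.sq_sqrt hκ.le, powScale_sq]
  linarith [e]

/-- On the whole DOOR WINDOW `0 < p < 2/51` of R16/R18 (`coarseUpper_of_package_pow`): the off-diagonal budget fails for every box-uniform first-order `b`. [cite: Luscher1983, §3] -/
theorem offDiag_budget_false_on_door_window {p κ : ℝ} (hp : p < 2 / 51) (hκ : 0 < κ) (ε θ : ℝ) :
    ¬ ∃ β0 : ℝ, ∀ β : ℝ, β0 ≤ β → ∃ b : ℝ, κ * powScale p β ≤ b ∧ b ^ 2 ≤ ε * θ * bareLambda ((L : ℝ) ^ 3 * β) / 16 :=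
  offDiag_budget_false_of_first_order L (by linarith) hκ ε θ

/-- On the whole door window `0 < p < 2/51`: the diagonal budget fails for every box-uniform second-order `η₂`. [cite: Luscher1983, §3] -/
theorem diag_budget_false_on_door_window {p κ : ℝ} (hp : p < 2 / 51) (hκ : 0 < κ) (ε : ℝ) :
    ¬ ∃ β0 : ℝ, ∀ β : ℝ, β0 ≤ β → ∃ η₂ : ℝ, κ * powScale (2 * p) β ≤ η₂ ∧ η₂ ≤ ε * bareLambda ((L : ℝ) ^ 3 * β) :=
  diag_budget_false_of_second_order L (by linarith) hκ ε

/-- SHARPNESS of the exponent: at `p = 1/6` a box-uniform first-order `b = κ·β^{−1/6}` DOES meet the budget for small `κ` — for `β ≥ 1`,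
`(κβ^{−1/6})² = κ²β^{−1/3} ≤ εθ·(2/L³)^{1/3}β^{−1/3}/16` iff `16κ² ≤ εθ(2/L³)^{1/3}`; so `p < 1/6` above is exactly the failing range (the cut radius of «brick R» is
`R ≍ (εθ)^{1/2}β^{−1/6}`). [folklore] -/
theorem offDiag_budget_at_one_sixth {κ ε θ : ℝ} (hbud : 16 * κ ^ 2 ≤ ε * θ * (2 / (L : ℝ) ^ 3) ^ ((1 : ℝ) / 3)) {β : ℝ} (hβ : 1 ≤ β) :
    ∃ b : ℝ, κ * powScale (1 / 6) β ≤ b ∧ b ^ 2 ≤ ε * θ * bareLambda ((L : ℝ) ^ 3 * β) / 16 := by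
  refine ⟨κ * powScale (1 / 6) β, le_rfl, ?_⟩
  have hβ0 : 0 < β := by linarith
  rw [mul_pow, powScale_sq, powScale_eq hβ, bareLambda_cube_eq (L := L) hβ0]
  have e : (2 : ℝ) * (1 / 6) = 1 / 3 := by norm_num
  have e' : β ^ (-(1 : ℝ) / 3) = β ^ (-(2 * (1 / 6) : ℝ)) := by rw [e]; congr 1; ring
  rw [e']
  have hb : 0 < β ^ (-(2 * (1 / 6) : ℝ)) := Real.rpow_pos_of_pos hβ0 _
  have : κ ^ 2 * β ^ (-(2 * (1 / 6) : ℝ)) ≤ ε * θ * (2 / (L : ℝ) ^ 3) ^ ((1 : ℝ) / 3) / 16 * β ^ (-(2 * (1 / 6) : ℝ)) :=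
    mul_le_mul_of_nonneg_right (by linarith) hb.le
  linarith

end Budget

end Summit.QuantumFields.YangMills.Theorems.TwistedTraceScaling.Negative.R21
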